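/- Copyright: the pub-balaban-gaps cell (G2 seat ne6, gen 9; row NE7b) — typist (first refusal, OWNER ruling W-ne7bp1-g104-4) of the
b2b-balaban T⁴-continuum CRUX team's INTERFACE REQUEST NE7b IR-104-2 «THE END AT THE TOWER, ONE STEP DEEPER: EXTRACTION DERIVED FROM
LOCAL CONDITIONAL STABILITY», part 2 of 2: the derivation `toPriced` and the road.  Released under the licence of the surrounding project. -/
import Summits.QuantumFields.BalabanUV.T4Continuum.Support.B16HistoryTowerExtractionStepDataLWR
import Summits.QuantumFields.BalabanUV.T4Continuum.Support.B16HistoryTowerExtractionEnd2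
import Summits.QuantumFields.BalabanUV.T4Continuum.Support.B16HistoryTowerEndDressing

/-!
# (α)-INSTANCE — THE END AT THE TOWER, ONE STEP DEEPER, part 2: `toPriced` (END2's record DERIVED from the one-step rows) and the
road `continuumYM4Torus_of_towerExtractionStep_fsc := END2 ∘ toPriced`

Summits-side support leaf of the T⁴-continuum cell (rung (B)+1 on a FINITE torus only; NOT infinite volume, NOT the mass gap, NOT
Clay; NOT a proof of NE7b — the cell's OWN estimate `T4WeightBudget.RelWeightBound`, NOT PRINTED, NOT PROVED).  [folklore] theorems
only (no `structure`, no `Prop` minted, no `[cite:]` tag, zero `sorry`): the OWNER's INTERFACE REQUEST NE7b IR-104-2 road (ruling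
W-ne7bp1-g104-4, journal l.51421: «`extractionLaws_of_LCS_of_subset` + `hread_keyPattern` ⇒ `extractA` DERIVED ⇒ END2's road»).

WHAT IS PROVED over one record `Sd : TowerExtractionStepDataLWR … μ` (part 1):
* §1 the DERIVED QUOTIENTS `qA Sd K k := exp (Σ_{j<K} (bA K k j − aA K k j))`, `qB Sd K k := exp (Σ_{j<K+1} (bB K k j − aB K k j))`;
  `hpres_of_step` (the termwise preservation from `hstep` + `hunit`, IR-102-1's `B16HistoryTowerEndDressing.hpres_of_stepIdentity`);
  **`extractA_of_LCS`** — END2's display `extractA` AT THE DERIVED QUOTIENT, from `pwA` + `lcsA` + the kernel rows: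
  `PrefixExtractionLaws.extract_of_prefix_of_subset` at the key pattern, its `hsub` = IR-104-1's `KeyPatternReading.fibre_kmemA_subset_badx`
  (`hν0`), its `hrel` = `LocalConditionalStability.hrel_of_LCS` (`hstep` ∕ `hintχ` restricted to the pattern prefixes by
  `PrefixExtraction.admS_subset_adm`), its telescoping displays = `hint ∕ hint′ ∕ hpres_of_step ∕ intA`, and `Real.exp_sum`;
  **`extractB_of_LCS`** — END2's `extractB` likewise ON THE CUTOFF-`(K+1)` TOWER, `hsub` = `KeyPatternReadingB.filterB_kmemA_subset_badx`
  (`hν0` + `htr0`), the pattern keyed by itself;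
* §2 **`toPriced Sd : TowerExtractionPricedDataLWR … (fun K ↦ μ K K)`** — END2's record FIELD FOR FIELD from `Sd`, with `qA ∕ qB` the derived
  quotients (`qA_nonneg ∕ qB_nonneg` by `exp_pos`), `extractA ∕ extractB := extractA_of_LCS ∕ extractB_of_LCS`, `priceA ∕ priceB := ledgerA ∕
  ledgerB` (the window ledgers ARE the price sentences at the derived quotient), every other field `Sd`'s own;
* §3 the road: **`hybridNE7Under_of_towerExtractionStep_fsc`**, **`targets_of_towerExtractionStep_fsc`**,
  **`continuumYM4Torus_of_towerExtractionStep_fsc`** = END2's three theorems with the `hRead` clause asking, for all small-coupling tuned runs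
  and every loop string, SOME record `TowerExtractionStepDataLWR … P X 𝒢 μ` at level measures (`ForSmallCouplings.mono` ∘ `toPriced`).
HONEST READING: the apex input ⇐ [BetaPertHyp ∧ ∀ small-coupling tuned run ∀ string: the step kernel identities + POINTWISE EXTRACTION and
LOCAL CONDITIONAL STABILITY per bad key along the key patterns + the window ledgers + NE7c + NE7 + rates + the reading's clauses + print's
per-step sentences, DISPLAYED].  What the (A1c) instance OWES of Bałaban's KIND is `lcsA ∕ lcsB` (and the by-definition `pwA ∕ pwB`) per
pinned event + `ledgerA ∕ ledgerB` + the identification; nothing of Bałaban's asserted, valued or discharged; BY-NAME EFFECT ON THE WALL: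
the per-key display `extractA ∕ extractB` is NO LONGER OWED — it is a theorem of the one-step rows; CONDITIONAL; NE7b NOT proved; count 0∕9.
HONEST DEPENDENCY (cell): continuum YM on T⁴ ⇐ BetaPertH ∧ nine spine estimates (0/9 proved); BetaPertH ⇐ (D1) ∧ (D4) ∧ CAP+tail;
G-an2-4 gates asym, D1 and NE2/3/4.  Unchanged.
-/
open Finset MeasureTheory
open Literature.MathematicalPhysics.QuantumFieldTheory.Balaban1983to89
open T4PersistenceDictionary T4PersistentHistoryCount T4BankedInduction T4PrintedShapeBanking
open T4WeightBudget T4GlobalDenominator T4LiveClassFibration T4LiveStructureGas T4LiveGasToTerms T4RecordPriceSeam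
open T4PartnerMultiplicity T4IndicatorShell T4MatchingAssembly T4MatchingClosure T4MatchingClosureSocket T4Continuum
open T4StabilitySocket T4BranchingRecordsGas T4TaggedShapeBanking T4CanonicalMenus T4RenewalChains
open Summit.QuantumFields.BalabanUV.T4Continuum.PlacementBatch Summit.QuantumFields.BalabanUV.T4Continuum.PlacementSkeleton
open Summit.QuantumFields.BalabanUV.T4Continuum.CountThresholdUniform Summit.QuantumFields.BalabanUV.T4Continuum.CountThresholdExit
open Summit.QuantumFields.BalabanUV.T4Continuum.CountSeamJunction Summit.QuantumFields.BalabanUV.T4Continuum.LateMergers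
open Summit.QuantumFields.BalabanUV.T4Continuum.HistoryFlow Summit.QuantumFields.BalabanUV.T4Continuum.HistoryRegeneration
open Summit.QuantumFields.BalabanUV.T4Continuum.HistoryTables Summit.QuantumFields.BalabanUV.T4Continuum.HistoryAssemblyTrees
open Summit.QuantumFields.BalabanUV.T4Continuum.HistoryAssemblyTerms Summit.QuantumFields.BalabanUV.T4Continuum.HistoryAssemblyPedigree
open Summit.QuantumFields.BalabanUV.T4Continuum.HistoryConstants Summit.QuantumFields.BalabanUV.T4Continuum.HistoryGen
open Literature.MathematicalPhysics.QuantumFieldTheory.Balaban1983to89.B13ScaleTransfer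
open Summit.QuantumFields.BalabanUV.T4Continuum.ZoneSkeleton Summit.QuantumFields.BalabanUV.T4Continuum.HistorySocketTH
open Summit.QuantumFields.BalabanUV.T4Continuum.HistoryCaps Summit.QuantumFields.BalabanUV.T4Continuum.HistoryAssemblyPrice
open Summit.QuantumFields.BalabanUV.T4Continuum.HistoryBankingLE Summit.QuantumFields.BalabanUV.T4Continuum.HistoryExitLE
open Summit.QuantumFields.BalabanUV.T4Continuum.HistoryAssemblyTreesLE Summit.QuantumFields.BalabanUV.T4Continuum.HistoryAssemblyTermsLE
open Summit.QuantumFields.BalabanUV.T4Continuum.HistoryRealise Summit.QuantumFields.BalabanUV.T4Continuum.HistoryAssemblyRealiseLE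
open Summit.QuantumFields.BalabanUV.T4Continuum.HistoryAssemblyMult Summit.QuantumFields.BalabanUV.T4Continuum.HistoryAssemblyMultKey
open Summit.QuantumFields.BalabanUV.T4Continuum.HistoryAssemblyRealiseRun Summit.QuantumFields.BalabanUV.T4Continuum.HistoryAssemblyRealiseMult
open Summit.QuantumFields.BalabanUV.T4Continuum.HistoryZones Summit.QuantumFields.BalabanUV.T4Continuum.HistoryRealiseCells
open Summit.QuantumFields.BalabanUV.T4Continuum.HistoryRealiseCellsRun Summit.QuantumFields.BalabanUV.T4Continuum.HistoryAssemblyRealiseRunMult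
open Summit.QuantumFields.BalabanUV.T4Continuum.HistoryRealiseCellsRunMult Summit.QuantumFields.BalabanUV.T4Continuum.HistoryAssemblyMultInstance
open Summit.QuantumFields.BalabanUV.T4Continuum.HistoryJoinsPlacedMember Summit.QuantumFields.BalabanUV.T4Continuum.PlacementSkeleton
open Summit.QuantumFields.BalabanUV.T4Continuum.HistoryJoinsPlacedMult Summit.QuantumFields.BalabanUV.T4Continuum.HistoryRealiseDistinct
open Summit.QuantumFields.BalabanUV.T4Continuum.HistoryRegionTemplates Summit.QuantumFields.BalabanUV.T4Continuum.HistoryCaps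
open Summit.QuantumFields.BalabanUV.T4Continuum.HistoryZoneEvolve (cth)
open Literature.MathematicalPhysics.QuantumFieldTheory.Balaban1983to89.B16SProfile (DropCtl)
open Summit.QuantumFields.BalabanUV.T4Continuum.HistoryRealiseCellsRunMultEnd Summit.QuantumFields.BalabanUV.T4Continuum.HistoryRealiseCellsRunMultEndD
open Summit.QuantumFields.BalabanUV.T4Continuum.HistoryRealiseCellsRunPinnedT3b Summit.QuantumFields.BalabanUV.T4Continuum.HistoryHybridRescale
open Summit.QuantumFields.BalabanUV.T4Continuum.HistoryRealiseCellsRunApex (exists_const_schemeZ)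
open Summit.QuantumFields.BalabanUV.T4Continuum.HistoryRealisePrint Summit.QuantumFields.BalabanUV.T4Continuum.HistoryRealiseWeak
open Summit.QuantumFields.BalabanUV.T4Continuum.HistoryRealisePrintReading Summit.QuantumFields.BalabanUV.T4Continuum.HistoryRealiseWeakReading
open Summit.QuantumFields.BalabanUV.T4Continuum.HistoryRealisePrintCells Summit.QuantumFields.BalabanUV.T4Continuum.HistoryRealiseWeakCells
open Summit.QuantumFields.BalabanUV.T4Continuum.HistoryRealiseCellsRunApexT3b Summit.QuantumFields.BalabanUV.T4Continuum.HistoryRealiseCellsRunApexT3bW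
open Summit.QuantumFields.BalabanUV.T4Continuum.HistoryRealiseCellsRunApexT3bWT Summit.QuantumFields.BalabanUV.T4Continuum.HistoryRealiseCellsRunPinnedT3bWT
open Summit.QuantumFields.BalabanUV.T4Continuum.HistoryRealiseCellsRunHeadlineT3bWT
open Summit.QuantumFields.BalabanUV.T4Continuum.HistoryRealiseCellsRunApexT3bWTV Summit.QuantumFields.BalabanUV.T4Continuum.HistoryBankingVolumePlug
open Summit.QuantumFields.BalabanUV.T4Continuum.HistoryRealiseCellsRunApexT3bWTVS
open Summit.QuantumFields.BalabanUV.T4Continuum.HistoryGenealogyRealise Summit.QuantumFields.BalabanUV.T4Continuum.HistoryGenealogyInstantiate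
open Summit.QuantumFields.BalabanUV.T4Continuum.B16HistoryIndexedRepr Summit.QuantumFields.BalabanUV.T4Continuum.B16HistoryIndexedTrunc
open Summit.QuantumFields.BalabanUV.T4Continuum.HistoryBankingDiscountCharge Summit.QuantumFields.BalabanUV.T4Continuum.HistoryBankingCreditRead
open Summit.QuantumFields.BalabanUV.T4Continuum.HistoryBankingFibreRoom Summit.QuantumFields.BalabanUV.T4Continuum.HistoryPriceKeys
open Summit.QuantumFields.BalabanUV.T4Continuum.HistoryRealiseCellsRunSupplyWTVS Summit.QuantumFields.BalabanUV.T4Continuum.HistoryRealiseCellsRunSupplyKeysWTVS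
open Summit.QuantumFields.BalabanUV.T4Continuum.HistoryRealiseCellsRunAssemblyWTVSData Summit.QuantumFields.BalabanUV.T4Continuum.HistoryRealiseCellsRunAssemblyWTVSDataL
open Summit.QuantumFields.BalabanUV.T4Continuum.HistoryBankingSharpShares (sBsharp ell)
open Summit.QuantumFields.BalabanUV.T4Continuum.HistoryBankingRoundingUnrounded (sRunr ApFlat)
open Summit.QuantumFields.BalabanUV.T4Continuum.HistoryBankingVolumeWindowLattice (uvolL)
open Literature.MathematicalPhysics.QuantumFieldTheory.Balaban1983to89.TreeLength Literature.MathematicalPhysics.QuantumFieldTheory.Balaban1983to89.B16MergeGeometry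
open Summit.QuantumFields.BalabanUV.T4Continuum.HistoryAdmissible Summit.QuantumFields.BalabanUV.T4Continuum.HistoryGenealogyExtraction
open Summit.QuantumFields.BalabanUV.T4Continuum.HistoryGenealogyPedigree Summit.QuantumFields.BalabanUV.T4Continuum.HistoryTouchComponents
open Summit.QuantumFields.BalabanUV.T4Continuum.B16HistoryReprChain Summit.QuantumFields.BalabanUV.T4Continuum.B16HistoryReprInstance
open Summit.QuantumFields.BalabanUV.T4Continuum.B16HistoryReprRead Summit.QuantumFields.BalabanUV.T4Continuum.B16HistoryReprReadCausal
open Summit.QuantumFields.BalabanUV.T4Continuum.B16HistoryStepDisplayPinned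
open Summit.QuantumFields.BalabanUV.T4Continuum.B16HistoryTowerEndDataLWL
open Literature.MathematicalPhysics.QuantumFieldTheory.Balaban1983to89.B16StepFactorsPrinted
open Literature.MathematicalPhysics.QuantumFieldTheory.Balaban1983to89.B16LargeFieldFactors380 (minConst)
open Summit.QuantumFields.BalabanUV.T4Continuum.B16HistoryStepJunction
open Summit.QuantumFields.BalabanUV.T4Continuum.B16HistoryTowerEndDataLWR
open Summit.QuantumFields.BalabanUV.T4Continuum.B16HistoryTowerEndPrinted
open Summit.QuantumFields.BalabanUV.T4Continuum.HistoryBankingSharpShares (ell)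
open Summit.QuantumFields.BalabanUV.T4Continuum.B16HistoryTowerEndPrintedR
open Summit.QuantumFields.BalabanUV.T4Continuum.B16HistoryTowerEndPrintedRRange

open Summit.QuantumFields.BalabanUV.T4Continuum.B16HistoryTowerStepRangeDataLWR
open Summit.QuantumFields.BalabanUV.T4Continuum.B16HistoryTowerExtractionPricedDataLWR
open Summit.QuantumFields.BalabanUV.T4Continuum.B16HistoryTowerExtractionEnd2
open Summit.QuantumFields.BalabanUV.T4Continuum.B16HistoryTowerExtractionStepDataLWR
open Summit.QuantumFields.BalabanUV.T4Continuum.B16HistoryTowerEndDressing (hpres_of_stepIdentity)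
open Summit.QuantumFields.BalabanUV.T4Continuum.NE7b.PrefixExtraction Summit.QuantumFields.BalabanUV.T4Continuum.NE7b.PrefixExtractionLaws
open Summit.QuantumFields.BalabanUV.T4Continuum.NE7b.LocalConditionalStability Summit.QuantumFields.BalabanUV.T4Continuum.NE7b.KeyPatternReading
open Summit.QuantumFields.BalabanUV.T4Continuum.NE7b.KeyPatternReadingB

namespace Summit.QuantumFields.BalabanUV.T4Continuum.B16HistoryTowerExtractionEnd3

noncomputable section

set_option synthInstance.maxSize 1024

/-! ## §1 Over one record: the derived quotients and END2's two extraction displays DERIVED -/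

section Derive

variable {F : T4Family} {G : Type*} [GaugeGroup G] [MeasurableSpace G] [HaarData G]
  {D : FiniteEpsData F G} {C : T4PrintedShapeBanking.Consts} {O : PrintedO1s} {θv : ℝ} {rr d n : ℕ} {hn : 0 < n}
  {g₀ : ℕ → ℝ} {os : List (ULoop F)} {cΛ M Φ b₀ : ℝ} {p₁ η η' κ κ₂ κᵥ : ℕ}
  {P : Type} [DecidableEq P] {X : ℕ → ℕ → Type} {𝒢 : (K j : ℕ) → GoodClass (X K j)}
  [∀ K j, MeasurableSpace (X K j)] {μ : (K j : ℕ) → Measure (X K j)} [∀ K, IsFiniteMeasure (μ K K)]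
  (Sd : TowerExtractionStepDataLWR D C O θv rr d n hn g₀ os cΛ M Φ b₀ p₁ η η' κ κ₂ κᵥ P X 𝒢 μ)

/-- **THE DERIVED QUOTIENT, run A**: `e^{Σ_{j<K} (bA K k j − aA K k j)}` — the product of the one-step rates `e^{b − a}` along the
window (`LocalConditionalStability.prod_exp_sub_eq`). [folklore] -/
def qA (K : ℕ) (k : Finset ((Fin d → ℕ) × Gen PEv × Multiset (PEv × ((Fin d → ℕ) × Finset (Pt d))))) : ℝ := Real.exp (∑ j ∈ Finset.range K, (Sd.bA K k j - Sd.aA K k j))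

/-- **THE DERIVED QUOTIENT, run B** (the cutoff-`(K+1)` tower: `K + 1` levels). [folklore] -/
def qB (K : ℕ) (k : Finset ((Fin d → ℕ) × Gen PEv × Multiset (PEv × ((Fin d → ℕ) × Finset (Pt d))))) : ℝ := Real.exp (∑ j ∈ Finset.range (K + 1), (Sd.bB K k j - Sd.aB K k j))

/-- the termwise preservation of every history term's integral by the sum over the next choices, on the window — from the kernel
rows `hstep ∕ hunit ∕ hint′ ∕ hintχ` (IR-102-1's `hpres_of_stepIdentity`). [folklore] -/
theorem hpres_of_step :
    ∀ K t, |t| ≤ Sd.l₀ → Sd.K₀ ≤ K → ∀ j g, j < K → g ∈ (Sd.T K).adm j →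
      ∫ x, (∑ p ∈ (Sd.T K).branch j g, ((Sd.T K).op j g p).T ((Sd.T K).eterm (Sd.ρ₀ K t) j g) x) ∂μ K (j + 1) =
        ∫ x, (Sd.T K).eterm (Sd.ρ₀ K t) j g x ∂μ K j :=
  hpres_of_stepIdentity Sd.T Sd.ρ₀ μ Sd.χ Sd.hρ₀ Sd.hstep Sd.hunit Sd.hint' Sd.hintχ

/-- **END2's EXTRACTION DISPLAY, run A, DERIVED** at the quotient `qA Sd`: on the window, the partial sum of M2-A's weights over the fibre
of a bad key is at most `qA Sd K k` times the full sum — `extract_of_prefix_of_subset` at the key pattern (`hsub` = IR-104-1's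
`fibre_kmemA_subset_badx`, `hrel` = `hrel_of_LCS` from `pwA ∕ lcsA ∕ hstep ∕ hintχ`, telescoping from `hint ∕ hint′ ∕ hpres_of_step ∕ intA`).
[folklore] -/
theorem extractA_of_LCS : ∀ K t, |t| ≤ Sd.l₀ → Sd.K₀ ≤ K →
    ∀ k ∈ badGMems (memA n F.L (Sd.𝒮.reading Sd.T Sd.p₀)) jhalf (HIndex.termSet (skelFam Sd.T Sd.p₀)) (kmemA n F.L hn (lt_of_lt_of_le (by norm_num) (two_le_L F)) (Sd.𝒮.reading Sd.T Sd.p₀)) K,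
      ∑ τ ∈ fibre (kmemA n F.L hn (lt_of_lt_of_le (by norm_num) (two_le_L F)) (Sd.𝒮.reading Sd.T Sd.p₀)) (HIndex.termSet (skelFam Sd.T Sd.p₀)) K k,
        Repr172R.weight (fun K => μ K K) (reprFam Sd.T Sd.p₀ Sd.ρ₀ Sd.hρ₀ Sd.h0 (fun _ _ => 1) (fun _ _ => one_pos)) t τ ≤
      qA Sd K k * ∑ τ ∈ HIndex.termSet (skelFam Sd.T Sd.p₀) K,
        Repr172R.weight (fun K => μ K K) (reprFam Sd.T Sd.p₀ Sd.ρ₀ Sd.hρ₀ Sd.h0 (fun _ _ => 1) (fun _ _ => one_pos)) t τ := by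
  intro K t ht hK k hk
  have hrel := hrel_of_LCS (T := Sd.T K) (μ := μ K) (Sd.hρ₀ K t) (Sd.h0 K t)
    (fun j g hj hg p hp f hf => Sd.hstep K hK j g p hj (admS_subset_adm _ _ j hg) hp f hf)
    (fun j g hj hg p hp => Sd.hintχ K t ht hK j g p hj (admS_subset_adm _ _ j hg) hp)
    (Sd.pwA K t ht hK k hk) (Sd.lcsA K t ht hK k hk)
  have h := extract_of_prefix_of_subset Sd.T Sd.p₀ Sd.ρ₀ Sd.hρ₀ Sd.h0 (fun _ _ => 1) (fun _ _ => one_pos) μ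
    (fun K k => keyPattern Sd.T Sd.p₀ (kmemA n F.L hn (lt_of_lt_of_le (by norm_num) (two_le_L F)) (Sd.𝒮.reading Sd.T Sd.p₀)) K k) (fun K k j => Real.exp (Sd.bA K k j - Sd.aA K k j)) Sd.hp₀ K t k
    (fibre_kmemA_subset_badx Sd.𝒮 Sd.T Sd.p₀ n F.L hn (lt_of_lt_of_le (by norm_num) (two_le_L F)) Sd.hν0 hk)
    (fun j => (Real.exp_pos _).le) hrel (Sd.hint K t ht hK) (Sd.hint' K t ht hK) (hpres_of_step Sd K t ht hK) (Sd.intA K t)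
  rwa [← Real.exp_sum] at h

/-- **END2's EXTRACTION DISPLAY, run B = the family at cutoff `K + 1` THROUGH `trunc`, DERIVED** at the quotient `qB Sd`: the same on the
cutoff-`(K+1)` tower, the sub-class `KeyPatternReadingB.filterB` read into run B's key pattern class by `filterB_kmemA_subset_badx`
(`hν0` + `htr0`), the pattern keyed by itself. [folklore] -/
theorem extractB_of_LCS : ∀ K t, |t| ≤ Sd.l₀ → Sd.K₀ ≤ K →
    ∀ k ∈ badGMems (memA n F.L (Sd.𝒮.reading Sd.T Sd.p₀)) jhalf (HIndex.termSet (skelFam Sd.T Sd.p₀)) (kmemA n F.L hn (lt_of_lt_of_le (by norm_num) (two_le_L F)) (Sd.𝒮.reading Sd.T Sd.p₀)) K,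
      ∑ τ' ∈ (HIndex.termSet (skelFam Sd.T Sd.p₀) (K + 1)).filter (fun τ' =>
          Sd.trunc K τ' ∈ fibre (kmemA n F.L hn (lt_of_lt_of_le (by norm_num) (two_le_L F)) (Sd.𝒮.reading Sd.T Sd.p₀)) (HIndex.termSet (skelFam Sd.T Sd.p₀)) K k),
        Repr172R.weight (fun K => μ K K) (reprFam Sd.T Sd.p₀ Sd.ρ₀ Sd.hρ₀ Sd.h0 (fun _ _ => 1) (fun _ _ => one_pos)) t τ' ≤
      qB Sd K k * ∑ τ' ∈ HIndex.termSet (skelFam Sd.T Sd.p₀) (K + 1),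
        Repr172R.weight (fun K => μ K K) (reprFam Sd.T Sd.p₀ Sd.ρ₀ Sd.hρ₀ Sd.h0 (fun _ _ => 1) (fun _ _ => one_pos)) t τ' := by
  intro K t ht hK k hk
  have hK' : Sd.K₀ ≤ K + 1 := Nat.le_succ_of_le hK
  have hrel := hrel_of_LCS (T := Sd.T (K + 1)) (μ := μ (K + 1)) (Sd.hρ₀ (K + 1) t) (Sd.h0 (K + 1) t)
    (fun j g hj hg p hp f hf => Sd.hstep (K + 1) hK' j g p hj (admS_subset_adm _ _ j hg) hp f hf)
    (fun j g hj hg p hp => Sd.hintχ (K + 1) t ht hK' j g p hj (admS_subset_adm _ _ j hg) hp)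
    (Sd.pwB K t ht hK k hk) (Sd.lcsB K t ht hK k hk)
  have h := extract_of_prefix_of_subset Sd.T Sd.p₀ Sd.ρ₀ Sd.hρ₀ Sd.h0 (fun _ _ => 1) (fun _ _ => one_pos) μ
    (fun _ (S : (j : ℕ) → (Fin j → P) → Finset P) => S) (fun _ _ j => Real.exp (Sd.bB K k j - Sd.aB K k j)) Sd.hp₀ (K + 1) t
    (keyPatternB Sd.T Sd.p₀ (kmemA n F.L hn (lt_of_lt_of_le (by norm_num) (two_le_L F)) (Sd.𝒮.reading Sd.T Sd.p₀)) Sd.trunc K k)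
    (filterB_kmemA_subset_badx Sd.T Sd.p₀ Sd.𝒮 n F.L hn (lt_of_lt_of_le (by norm_num) (two_le_L F)) Sd.trunc Sd.hν0 Sd.htr0 hk)
    (fun j => (Real.exp_pos _).le) hrel (Sd.hint (K + 1) t ht hK') (Sd.hint' (K + 1) t ht hK') (hpres_of_step Sd (K + 1) t ht hK')
    (Sd.intA (K + 1) t)
  rwa [← Real.exp_sum] at h

end Derive

/-! ## §2 END2's record DERIVED from the one-step record -/

section ToPriced

variable {F : T4Family} {G : Type*} [GaugeGroup G] [MeasurableSpace G] [HaarData G]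
  {D : FiniteEpsData F G} {C : T4PrintedShapeBanking.Consts} {O : PrintedO1s} {θv : ℝ} {rr d n : ℕ} {hn : 0 < n}
  {g₀ : ℕ → ℝ} {os : List (ULoop F)} {cΛ M Φ b₀ : ℝ} {p₁ η η' κ κ₂ κᵥ : ℕ}
  {P : Type} [DecidableEq P] {X : ℕ → ℕ → Type} {𝒢 : (K j : ℕ) → GoodClass (X K j)}
  [∀ K j, MeasurableSpace (X K j)] {μ : (K j : ℕ) → Measure (X K j)} [∀ K, IsFiniteMeasure (μ K K)]

/-- **END2's RECORD FROM THE ONE-STEP RECORD** (`μ K := μ K K`): field for field `Sd`'s own, except the DERIVED quotients `qA ∕ qB`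
(non-negative as exponentials), the DERIVED displays `extractA ∕ extractB := extractA_of_LCS ∕ extractB_of_LCS`, and the price sentences
`priceA ∕ priceB := ledgerA ∕ ledgerB` (the window ledgers at the derived quotient). [folklore] -/
def toPriced (Sd : TowerExtractionStepDataLWR D C O θv rr d n hn g₀ os cΛ M Φ b₀ p₁ η η' κ κ₂ κᵥ P X 𝒢 μ) :
    TowerExtractionPricedDataLWR D C O θv rr d n hn g₀ os cΛ M Φ b₀ p₁ η η' κ κ₂ κᵥ P X 𝒢 (fun K => μ K K) :=
  { l₀ := Sd.l₀, vol := Sd.vol, l₀_pos := Sd.l₀_pos, vol_pos := Sd.vol_pos, K₀ := Sd.K₀, T := Sd.T, p₀ := Sd.p₀, hp₀ := Sd.hp₀,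
    ρ₀ := Sd.ρ₀, hρ₀ := Sd.hρ₀, h0 := Sd.h0, intA := Sd.intA, H2A := Sd.H2A, 𝒮 := Sd.𝒮, hL := Sd.hL, hs := Sd.hs, hν0 := Sd.hν0,
    hν := Sd.hν, hRm := Sd.hRm, hRmS := Sd.hRmS, hRm2 := Sd.hRm2, c := Sd.c, Xs := Sd.Xs, hC' := Sd.hC', hC380 := Sd.hC380,
    hcΛc := Sd.hcΛc, hℓ1 := Sd.hℓ1, hβ := Sd.hβ, hdisp := Sd.hdisp, hclass := Sd.hclass, hΩ := Sd.hΩ, hcube := Sd.hcube,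
    hd := Sd.hd, hR := Sd.hR, hP := Sd.hP, isRj := Sd.isRj, one_le_R := Sd.one_le_R, hL4 := Sd.hL4, hprof := Sd.hprof,
    hdrop := Sd.hdrop, hD := Sd.hD, hreg := Sd.hreg, hn₁ := Sd.hn₁, hE₂ := Sd.hE₂, hE₃pos := Sd.hE₃pos, β' := Sd.β',
    h29 := Sd.h29, hcΛ := Sd.hcΛ, hMΛ := Sd.hMΛ, hℓ := Sd.hℓ, trunc := Sd.trunc, htr := Sd.htr,
    qA := qA Sd,
    qB := qB Sd,
    qA_nonneg := fun _ _ _ _ => (Real.exp_pos _).le,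
    qB_nonneg := fun _ _ _ _ => (Real.exp_pos _).le,
    extractA := extractA_of_LCS Sd,
    extractB := extractB_of_LCS Sd,
    priceA := Sd.ledgerA,
    priceB := Sd.ledgerB,
    shA := Sd.shA, shB := Sd.shB, Wsh := Sd.Wsh, shell := Sd.shell, Cc := Sd.Cc, Rr := Sd.Rr, CcRec := Sd.CcRec,
    RrRec := Sd.RrRec, ν := Sd.ν, u := Sd.u, s₂ := Sd.s₂, q₀ := Sd.q₀, r := Sd.r, s := Sd.s, budget := Sd.budget,
    sum_r := Sd.sum_r, sum_u := Sd.sum_u, sum_s := Sd.sum_s, sum_s₂ := Sd.sum_s₂, hθv := Sd.hθv, hβ₀ := Sd.hβ₀, hΦ := Sd.hΦ,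
    m := Sd.m, hm := Sd.hm, hexpR := Sd.hexpR, hexpR' := Sd.hexpR', hexpB := Sd.hexpB, hexpFL := Sd.hexpFL, hdq := Sd.hdq,
    hexpVL := Sd.hexpVL, hη := Sd.hη, hη' := Sd.hη', hκ := Sd.hκ, hκ₂ := Sd.hκ₂, hκᵥ := Sd.hκᵥ, hp₀c := Sd.hp₀c, hγ₀ := Sd.hγ₀,
    hA₁ := Sd.hA₁, hA₀ := Sd.hA₀, hM := Sd.hM, hγc := Sd.hγc, hAc := Sd.hAc, hpc := Sd.hpc, hmc := Sd.hmc, p27 := Sd.p27,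
    hp27 := Sd.hp27, h27 := Sd.h27 }

end ToPriced

/-! ## §3 The road: END2 ∘ `toPriced` -/

section Under

variable {F : T4Family} {G : Type*} [GaugeGroup G] [MeasurableSpace G] [HaarData G]

/-- **THE APEX INPUT FROM A TOWER FAMILY CARRYING THE ONE-STEP ROWS** (step kernel identities, pointwise extraction + local conditional
stability per bad key along the key patterns, the window ledgers): END2's `hybridNE7Under_of_towerExtractionPriced_fsc` with its `hRead`
clause supplied, per tuned run and string, by `toPriced` of SOME `TowerExtractionStepDataLWR … P X 𝒢 μ` at level measures
(`ForSmallCouplings.mono`).  CONDITIONAL; NE7b NOT proved. [folklore] -/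
theorem hybridNE7Under_of_towerExtractionStep_fsc (D : FiniteEpsData F G)
    {C : T4PrintedShapeBanking.Consts} {O : PrintedO1s}
    {rr : ℕ} {β₀ : ℝ} (h : ThresholdOK C F.L rr β₀) (hμ : 0 < C.μ) (d n : ℕ)
    (hκ₁ : (d : ℝ) * Real.log F.L + 2 * Real.log 2 ≤ C.κ₁) (hE₀ : Real.log (2 + birthMass C) ≤ C.E₀)
    (hA₀ : 1 ≤ C.A₀) (hβ₀ : 0 < β₀) (hLβ : (F.L : ℝ) * β₀ ≤ 1) (hn₁ : 13 ≤ C.n₁) (hn : 0 < n)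
    {θ : ℝ} (hθ : 0 < θ) (hslack : C.a + θ ≤ O.γ₀ * O.A₁ ^ 2 / 2)
    (hE₂ : 0 < C.E₂) (hE₃ : 0 ≤ C.E₃) {sS : ℕ} (hsS : 1 ≤ sS)
    (hsmall : (((2 * cth 32 1 sS + 1) ^ d : ℕ) : ℝ) * (5 : ℝ) ^ d * ((max 1 (2 * 32 + 2) : ℕ) : ℝ) ≤
      (F.L : ℝ) ^ (sS / 2) / 2)
    {θc : ℝ} (hθc0 : 0 ≤ θc) (hθc1 : θc < 1) (hθcs : 1 / 2 ≤ θc ^ sS)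
    {θv cΛ M Φ b₀ : ℝ} {p₁ η η' κ κ₂ κᵥ : ℕ}
    (hRead : T4ContinuumYM4Torus.ForSmallCouplings D fun g₀ => ∀ os : List (ULoop F),
      ∃ (P : Type) (_ : DecidableEq P) (X : ℕ → ℕ → Type) (𝒢 : (K j : ℕ) → GoodClass (X K j))
        (_ : ∀ K j, MeasurableSpace (X K j)) (μ : (K j : ℕ) → Measure (X K j)) (_ : ∀ K, IsFiniteMeasure (μ K K)),
        Nonempty (TowerExtractionStepDataLWR D C O θv rr d n hn g₀ os cΛ M Φ b₀ p₁ η η' κ κ₂ κᵥ P X 𝒢 μ)) :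
    T4ApexHybrid.HybridNE7Under D (BetaPertHyp D.βfun) :=
  hybridNE7Under_of_towerExtractionPriced_fsc D h hμ d n hκ₁ hE₀ hA₀ hβ₀ hLβ hn₁ hn hθ hslack hE₂ hE₃ hsS hsmall hθc0 hθc1 hθcs
    (hRead.mono fun g₀ H os => by
      obtain ⟨P, _, X, 𝒢, _, μ, _, ⟨Sd⟩⟩ := H os
      exact ⟨P, inferInstance, X, 𝒢, inferInstance, fun K => μ K K, inferInstance, ⟨toPriced Sd⟩⟩)

end Under

section SU

variable {F : T4Family} {N : ℕ} [NeZero N] {ℰ : LoopAverage (Matrix.specialUnitaryGroup (Fin N) ℂ)}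

/-- **THE FOUR T⁴ TARGETS FROM A TOWER FAMILY CARRYING THE ONE-STEP ROWS**, for (0.4)-block-averaged data on `SU(N)` with a measurable
small-loop average — `T4ApexHybrid.targets_of_hybridNE7Under` ∘ §3.  CONDITIONAL on (B), `BetaPertHyp` and everything the record displays;
NE7b NOT proved. [folklore] -/
theorem targets_of_towerExtractionStep_fsc (D : FiniteEpsData F (Matrix.specialUnitaryGroup (Fin N) ℂ))
    (hBA : D.IsBlockAveraged ℰ) (hE : ℰ.MeasurableE)
    {C : T4PrintedShapeBanking.Consts} {O : PrintedO1s}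
    {rr : ℕ} {β₀ : ℝ} (h : ThresholdOK C F.L rr β₀) (hμ : 0 < C.μ) (d n : ℕ)
    (hκ₁ : (d : ℝ) * Real.log F.L + 2 * Real.log 2 ≤ C.κ₁) (hE₀ : Real.log (2 + birthMass C) ≤ C.E₀)
    (hA₀ : 1 ≤ C.A₀) (hβ₀ : 0 < β₀) (hLβ : (F.L : ℝ) * β₀ ≤ 1) (hn₁ : 13 ≤ C.n₁) (hn : 0 < n)
    {θ : ℝ} (hθ : 0 < θ) (hslack : C.a + θ ≤ O.γ₀ * O.A₁ ^ 2 / 2)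
    (hE₂ : 0 < C.E₂) (hE₃ : 0 ≤ C.E₃) {sS : ℕ} (hsS : 1 ≤ sS)
    (hsmall : (((2 * cth 32 1 sS + 1) ^ d : ℕ) : ℝ) * (5 : ℝ) ^ d * ((max 1 (2 * 32 + 2) : ℕ) : ℝ) ≤
      (F.L : ℝ) ^ (sS / 2) / 2)
    {θc : ℝ} (hθc0 : 0 ≤ θc) (hθc1 : θc < 1) (hθcs : 1 / 2 ≤ θc ^ sS)
    {θv cΛ M Φ b₀ : ℝ} {p₁ η η' κ κ₂ κᵥ : ℕ}
    (hRead : T4ContinuumYM4Torus.ForSmallCouplings D fun g₀ => ∀ os : List (ULoop F),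
      ∃ (P : Type) (_ : DecidableEq P) (X : ℕ → ℕ → Type) (𝒢 : (K j : ℕ) → GoodClass (X K j))
        (_ : ∀ K j, MeasurableSpace (X K j)) (μ : (K j : ℕ) → Measure (X K j)) (_ : ∀ K, IsFiniteMeasure (μ K K)),
        Nonempty (TowerExtractionStepDataLWR D C O θv rr d n hn g₀ os cΛ M Φ b₀ p₁ η η' κ κ₂ κᵥ P X 𝒢 μ)) :
    D.ym4_torus_continuum_limit_exists ∧ D.ym4_torus_continuum_limit_unique ∧
      D.limit_reflectionPositive ∧ D.limit_torusCovariant :=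
  T4ApexHybrid.targets_of_hybridNE7Under hBA hE
    (hybridNE7Under_of_towerExtractionStep_fsc D h hμ d n hκ₁ hE₀ hA₀ hβ₀ hLβ hn₁ hn hθ hslack hE₂ hE₃ hsS hsmall hθc0 hθc1
      hθcs hRead)

/-- **THE HEADLINE PREDICATE FROM A TOWER FAMILY CARRYING THE ONE-STEP ROWS — EXTRACTION DERIVED**: `ContinuumYM4Torus D` for
(0.4)-block-averaged data on `SU(N)` with a measurable small-loop average, GIVEN the pins `(B) = B16.EndStatementBPrinted D.C` and
`BetaPertHyp D.βfun` BY NAME, END2's constants-side binders (`ThresholdOK`, `0 < C.μ`, the κ₁∕E₀ largeness, `1 ≤ A₀`, `0 < β₀`, `L·β₀ ≤ 1`,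
`13 ≤ n₁`, `0 < n`, `0 < θ` with the unsplit slack `C.a + θ ≤ ½γ₀A₁²`, `0 < E₂`, `0 ≤ E₃`, row S6g′'s `sS ∕ θc` arithmetic), the eleven
window letters, and — for all small-coupling tuned runs and every loop string — SOME record `TowerExtractionStepDataLWR … P X 𝒢 μ` (four
carriers, level measures).  Proof: the targets ∘ `continuumYM4Torus_of_targets`.  CONDITIONAL on everything the record displays (the step
kernel identities, `pwA ∕ lcsA ∕ pwB ∕ lcsB`, `ledgerA ∕ ledgerB`, the reading's clauses, NE7c, NE7, rates, flow, print's sentences);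
NE7b NOT proved; count 0∕9. [folklore] -/
theorem continuumYM4Torus_of_towerExtractionStep_fsc (D : FiniteEpsData F (Matrix.specialUnitaryGroup (Fin N) ℂ))
    (hBA : D.IsBlockAveraged ℰ) (hE : ℰ.MeasurableE) (hB : B16.EndStatementBPrinted D.C) (hβ : BetaPertHyp D.βfun)
    {C : T4PrintedShapeBanking.Consts} {O : PrintedO1s}
    {rr : ℕ} {β₀ : ℝ} (h : ThresholdOK C F.L rr β₀) (hμ : 0 < C.μ) (d n : ℕ)
    (hκ₁ : (d : ℝ) * Real.log F.L + 2 * Real.log 2 ≤ C.κ₁) (hE₀ : Real.log (2 + birthMass C) ≤ C.E₀)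
    (hA₀ : 1 ≤ C.A₀) (hβ₀ : 0 < β₀) (hLβ : (F.L : ℝ) * β₀ ≤ 1) (hn₁ : 13 ≤ C.n₁) (hn : 0 < n)
    {θ : ℝ} (hθ : 0 < θ) (hslack : C.a + θ ≤ O.γ₀ * O.A₁ ^ 2 / 2)
    (hE₂ : 0 < C.E₂) (hE₃ : 0 ≤ C.E₃) {sS : ℕ} (hsS : 1 ≤ sS)
    (hsmall : (((2 * cth 32 1 sS + 1) ^ d : ℕ) : ℝ) * (5 : ℝ) ^ d * ((max 1 (2 * 32 + 2) : ℕ) : ℝ) ≤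
      (F.L : ℝ) ^ (sS / 2) / 2)
    {θc : ℝ} (hθc0 : 0 ≤ θc) (hθc1 : θc < 1) (hθcs : 1 / 2 ≤ θc ^ sS)
    {θv cΛ M Φ b₀ : ℝ} {p₁ η η' κ κ₂ κᵥ : ℕ}
    (hRead : T4ContinuumYM4Torus.ForSmallCouplings D fun g₀ => ∀ os : List (ULoop F),
      ∃ (P : Type) (_ : DecidableEq P) (X : ℕ → ℕ → Type) (𝒢 : (K j : ℕ) → GoodClass (X K j))
        (_ : ∀ K j, MeasurableSpace (X K j)) (μ : (K j : ℕ) → Measure (X K j)) (_ : ∀ K, IsFiniteMeasure (μ K K)),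
        Nonempty (TowerExtractionStepDataLWR D C O θv rr d n hn g₀ os cΛ M Φ b₀ p₁ η η' κ κ₂ κᵥ P X 𝒢 μ)) :
    T4ContinuumYM4Torus.ContinuumYM4Torus D :=
  T4ContinuumYM4Torus.continuumYM4Torus_of_targets hB hβ
    (targets_of_towerExtractionStep_fsc D hBA hE h hμ d n hκ₁ hE₀ hA₀ hβ₀ hLβ hn₁ hn hθ hslack hE₂ hE₃ hsS hsmall hθc0 hθc1
      hθcs hRead)

end SU

end

end Summit.QuantumFields.BalabanUV.T4Continuum.B16HistoryTowerExtractionEnd3
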